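import Summits.HubbardSuperconductivity.HubbardSuperconductivity.Theorems.AnisotropyChordTwoMagnonBranchSetup
import Summits.HubbardSuperconductivity.HubbardSuperconductivity.Theorems.AnisotropyChordResolventGramTPMinors
import Summits.HubbardSuperconductivity.HubbardSuperconductivity.Theorems.AnisotropyChordSpinMonotoneTwoMagnonTorus

/-!
# Route `AnisotropyChord`: COROLLARY TP-W2 — the two-magnon ground-state curve of a connected
# vertex- and edge-transitive graph has a TOTALLY POSITIVE (TP₂) Gram kernel on `Δ ≤ 1`, and
# ground-state OVERLAP MONOTONICITY (OM) follows (theory seat `hubbard-h0-rotor-theory-1`, cycle 6)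

**Theorem** (`twoMagnon_gramTP2_of_edgeTransitive`).  Let `G` be finite, connected, vertex- and
edge-transitive (all square tori `(ℤ/Lℤ)²`, cycles, hypercubes, `K_n`, `K_{m,m}`, Petersen, …).  In
the two-magnon sector `S^z_tot = |V|/2 − 2` of `H(Δ) = xxzHamiltonian 1 G (−1) Δ` let `ψ(Δ)` denote a
normalised sector ground state.  For `Δ₁ ≤ Δ₂ ≤ 1` (rows) and `Δ₃ ≤ Δ₄ ≤ 1` (columns),

  `|⟨ψ(Δ₁), ψ(Δ₄)⟩| · |⟨ψ(Δ₂), ψ(Δ₃)⟩| ≤ |⟨ψ(Δ₁), ψ(Δ₃)⟩| · |⟨ψ(Δ₂), ψ(Δ₄)⟩|`,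

i.e. every `2 × 2` minor of the kernel `(Δ, Δ') ↦ |⟨ψ(Δ), ψ(Δ')⟩|` is non-negative: the W = 2,
one-contact-orbit case of the theory seat's CONJECTURE TP-VT (`VertexTransitiveGroundStateGramTP2`,
memo ROTOR-THEORY-6 §52; numerically TP₂ ∧ TP₃ on 15 vertex-transitive graphs, false off the class),
here a THEOREM with no lower bound on the anisotropies.

**Corollary** (`twoMagnon_overlapMonotone_of_edgeTransitive`, (OM) for W = 2): for
`Δ₁ ≤ Δ₁' ≤ Δ₂ ≤ 1`, `|⟨ψ(Δ₁), ψ(Δ₂)⟩| ≤ |⟨ψ(Δ₁'), ψ(Δ₂)⟩|` — the fidelity to a ground state at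
larger anisotropy is non-decreasing (TP₂ with unit diagonal + Cauchy–Schwarz).  With `Δ₂ = 1` this is
the flat-fidelity monotonicity behind the rung TM-VT (`twoMagnon_condensate_monotone_of_edgeTransitive`).

Proof.  `…TwoMagnonBranchSetup`: on the `Aut G`-invariant block the sector ground states for `Δ < 1`
are states on the ground branch of the rank-one family `L + ((1−Δ)/m)|t⟩⟨t|`, `L = H(1) + m/4 ⪰ 0`,
with levels `ε(Δ)` decreasing in `Δ`; `…ResolventGramTPMinors`: along such a branch every state is a
multiple of the resolvent vector `(L − ε)⁻¹ t`, the Gram kernel is a Cauchy–Gram kernel with all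
levels in the first spectral gap, and LEMMA TP₂ (`cauchyGram_minor_nonneg`, Binet–Cauchy + Cauchy
determinant) gives the minors; the end point `Δ = 1` (flat state `e`, `σ = 0`) is the flat
column / flat corner of that file, and coincident parameters are Perron–Frobenius uniqueness.

What this does NOT say: nothing for two contact orbits (anisotropic tori) or `W ≥ 3` — there TP-VT
remains the theory seat's conjecture.  S. Karlin, *Total Positivity* (1968) Ch. 3; H. Tasaki (2020)
§2.4, App. A; B. Simon, *Trace Ideals* (2005) §11.  No definition is introduced.
-/

set_option linter.dupNamespace false

noncomputable section

namespace Summit.HubbardSuperconductivity.HubbardSuperconductivity.Theorems.AnisotropyChord.TwoMagnon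

open Matrix Complex Finset
open scoped ComplexOrder InnerProductSpace
open Literature.MathematicalPhysics.QuantumLattice Literature.Probability.LatticeModels
open Literature.Combinatorics.SimpleGraph (IsVertexTransitive)
open Literature.Combinatorics.SimpleGraph.LovaszThetaEdgeTransitive (IsEdgeTransitive)
open Literature.Combinatorics.SimpleGraph.RankThreeStronglyRegular (isRegularOfDegree_of_isVertexTransitive)
open Summit.HubbardSuperconductivity.HubbardSuperconductivity.Theorems.AnisotropyChord.OneMagnon
open Summit.HubbardSuperconductivity.HubbardSuperconductivity.Theorems.LevyLogBootstrap

variable {V : Type*} [Fintype V] [DecidableEq V]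

/-- `|⟨c e, x⟩| = |c| |⟨e, x⟩|`. [folklore] -/
theorem norm_star_smul_dotProduct (c : ℂ) (e x : (V → Fin 2) → ℂ) :
    ‖star (c • e) ⬝ᵥ x‖ = ‖c‖ * ‖star e ⬝ᵥ x‖ := by
  rw [star_smul, smul_dotProduct, smul_eq_mul, norm_mul, norm_star]

/-- `|⟨x, c e⟩| = |c| |⟨x, e⟩|`. [folklore] -/
theorem norm_star_dotProduct_smul (c : ℂ) (x e : (V → Fin 2) → ℂ) :
    ‖star x ⬝ᵥ (c • e)‖ = ‖c‖ * ‖star x ⬝ᵥ e‖ := by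
  rw [dotProduct_smul, smul_eq_mul, norm_mul]

/-- `|⟨x, y⟩| = |⟨y, x⟩|`. [folklore] -/
theorem norm_star_dotProduct_comm (x y : (V → Fin 2) → ℂ) :
    ‖star x ⬝ᵥ y‖ = ‖star y ⬝ᵥ x‖ := by
  rw [star_dotProduct x y, norm_star]

/-- **COROLLARY TP-W2 — TP₂ of the two-magnon ground-state Gram kernel on connected vertex- and
edge-transitive graphs** (see the module docstring): for `Δ₁ ≤ Δ₂ ≤ 1`, `Δ₃ ≤ Δ₄ ≤ 1` and normalised
two-magnon sector ground states `ψᵢ` of `H(Δᵢ)`,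
`|⟨ψ₁,ψ₄⟩| |⟨ψ₂,ψ₃⟩| ≤ |⟨ψ₁,ψ₃⟩| |⟨ψ₂,ψ₄⟩|`.  Theory seat `hubbard-h0-rotor-theory-1`, memo
ROTOR-THEORY-6 §52 (COROLLARY TP-W2); Karlin (1968) Ch. 3; Tasaki (2020) §2.4. [folklore] -/
theorem twoMagnon_gramTP2_of_edgeTransitive (G : SimpleGraph V) [DecidableRel G.Adj]
    (hG : G.Connected) (hVT : IsVertexTransitive G) (hET : IsEdgeTransitive G)
    {Δ₁ Δ₂ Δ₃ Δ₄ : ℝ} (h12 : Δ₁ ≤ Δ₂) (h2 : Δ₂ ≤ 1) (h34 : Δ₃ ≤ Δ₄) (h4 : Δ₄ ≤ 1)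
    {ψ₁ ψ₂ ψ₃ ψ₄ : (V → Fin 2) → ℂ}
    (g₁m : ψ₁ ∈ spinZSector (Λ := V) 1 ((Fintype.card V : ℝ) / 2 - 2)) (g₁n : star ψ₁ ⬝ᵥ ψ₁ = 1)
    (g₁e : xxzHamiltonian 1 G (-1) Δ₁ *ᵥ ψ₁ =
      ((lowestEnergyInSector 1 (xxzHamiltonian 1 G (-1) Δ₁) ((Fintype.card V : ℝ) / 2 - 2) : ℝ) : ℂ) • ψ₁)
    (g₂m : ψ₂ ∈ spinZSector (Λ := V) 1 ((Fintype.card V : ℝ) / 2 - 2)) (g₂n : star ψ₂ ⬝ᵥ ψ₂ = 1)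
    (g₂e : xxzHamiltonian 1 G (-1) Δ₂ *ᵥ ψ₂ =
      ((lowestEnergyInSector 1 (xxzHamiltonian 1 G (-1) Δ₂) ((Fintype.card V : ℝ) / 2 - 2) : ℝ) : ℂ) • ψ₂)
    (g₃m : ψ₃ ∈ spinZSector (Λ := V) 1 ((Fintype.card V : ℝ) / 2 - 2)) (g₃n : star ψ₃ ⬝ᵥ ψ₃ = 1)
    (g₃e : xxzHamiltonian 1 G (-1) Δ₃ *ᵥ ψ₃ =
      ((lowestEnergyInSector 1 (xxzHamiltonian 1 G (-1) Δ₃) ((Fintype.card V : ℝ) / 2 - 2) : ℝ) : ℂ) • ψ₃)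
    (g₄m : ψ₄ ∈ spinZSector (Λ := V) 1 ((Fintype.card V : ℝ) / 2 - 2)) (g₄n : star ψ₄ ⬝ᵥ ψ₄ = 1)
    (g₄e : xxzHamiltonian 1 G (-1) Δ₄ *ᵥ ψ₄ =
      ((lowestEnergyInSector 1 (xxzHamiltonian 1 G (-1) Δ₄) ((Fintype.card V : ℝ) / 2 - 2) : ℝ) : ℂ) • ψ₄) :
    ‖star ψ₁ ⬝ᵥ ψ₄‖ * ‖star ψ₂ ⬝ᵥ ψ₃‖ ≤ ‖star ψ₁ ⬝ᵥ ψ₃‖ * ‖star ψ₂ ⬝ᵥ ψ₄‖ := by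
  have hne : ∀ {ψ : (V → Fin 2) → ℂ}, star ψ ⬝ᵥ ψ = 1 → ψ ≠ 0 := by
    intro ψ h h0; rw [h0, dotProduct_zero] at h; exact zero_ne_one h
  -- coincident parameters: Perron–Frobenius uniqueness (both sides agree)
  rcases h12.lt_or_eq with hlt12 | heq12
  swap
  · subst heq12
    obtain ⟨c, hc⟩ := sectorGS_smul_of_sectorGS G hG Δ₁ _ g₁m (hne g₁n) g₁e g₂m g₂e
    rw [hc, norm_star_smul_dotProduct, norm_star_smul_dotProduct]
    nlinarith [norm_nonneg c]
  rcases h34.lt_or_eq with hlt34 | heq34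
  swap
  · subst heq34
    obtain ⟨c, hc⟩ := sectorGS_smul_of_sectorGS G hG Δ₃ _ g₃m (hne g₃n) g₃e g₄m g₄e
    rw [hc, norm_star_dotProduct_smul, norm_star_dotProduct_smul]
    nlinarith [norm_nonneg c]
  have hΔ₁ : Δ₁ < 1 := lt_of_lt_of_le hlt12 h2
  have hΔ₃ : Δ₃ < 1 := lt_of_lt_of_le hlt34 h4
  -- the flat vector, a vertex, an edge, regularity, a contact indicator
  have hsupp₁ := apply_eq_zero_of_mem_twoMagnonSector g₁m
  obtain ⟨σ₀, hσ₀⟩ := Function.ne_iff.mp (hne g₁n)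
  have hw : (∑ z, (σ₀ z : ℕ)) = 2 := by
    by_contra h
    exact hσ₀ (hsupp₁ σ₀ h)
  obtain ⟨i₀, j₀, hij₀, -⟩ := eq_pair_of_weight_eq_two hw
  have hm : G.edgeFinset.card ≠ 0 := by
    obtain ⟨p⟩ := hG.preconnected i₀ j₀
    cases p with
    | nil => exact absurd rfl hij₀
    | cons h _ =>
      exact Finset.card_ne_zero_of_mem (SimpleGraph.mem_edgeFinset.2 ((SimpleGraph.mem_edgeSet G).2 h))
  have hreg : G.IsRegularOfDegree (G.degree i₀) := isRegularOfDegree_of_isVertexTransitive hVT i₀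
  obtain ⟨t', ht2', ht0'⟩ := exists_adjInd G
  set φ : (V → Fin 2) → ℂ := fun σ => if (∑ z, (σ z : ℕ)) = 2 then 1 else 0 with hφdef
  have hφ : ∀ σ, φ σ = if (∑ z, (σ z : ℕ)) = 2 then 1 else 0 := fun σ => rfl
  have hφ0 : φ ≠ 0 := by
    intro h
    have h1 : φ σ₀ = 0 := by rw [h]; rfl
    rw [hφ σ₀, if_pos hw] at h1
    exact one_ne_zero h1
  obtain ⟨L, 𝓜, e, t, r, hL, h𝓜L, he𝓜, ht𝓜, hLe, he1, ha0, -, -, hflat, hbr⟩ :=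
    twoMagnon_branch_setup G hG hVT hET i₀ hφ hφ0
  -- the two states that are always on the branch
  obtain ⟨h₁𝓜, hs₁, heq₁, hb₁, hfix₁, hvar₁, huniq₁⟩ := hbr Δ₁ ψ₁ hΔ₁ g₁m g₁n g₁e
  obtain ⟨h₃𝓜, hs₃, heq₃, hb₃, hfix₃, hvar₃, huniq₃⟩ := hbr Δ₃ ψ₃ hΔ₃ g₃m g₃n g₃e
  -- level ordering
  have anti : ∀ {Δ Δ' : ℝ} {ψ : (V → Fin 2) → ℂ}, Δ ≤ Δ' →
      ψ ∈ spinZSector (Λ := V) 1 ((Fintype.card V : ℝ) / 2 - 2) → star ψ ⬝ᵥ ψ = 1 →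
      xxzHamiltonian 1 G (-1) Δ *ᵥ ψ =
        ((lowestEnergyInSector 1 (xxzHamiltonian 1 G (-1) Δ) ((Fintype.card V : ℝ) / 2 - 2) : ℝ) : ℂ) • ψ →
      (∀ π : V ≃ V, (∀ x y, G.Adj (π x) (π y) ↔ G.Adj x y) → ∀ σ, ψ (σ ∘ π) = ψ σ) →
      lowestEnergyInSector 1 (xxzHamiltonian 1 G (-1) Δ') ((Fintype.card V : ℝ) / 2 - 2)
          - (1 - Δ') * ((G.edgeFinset.card : ℝ) / 4 - G.degree i₀) + (G.edgeFinset.card : ℝ) / 4 ≤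
        lowestEnergyInSector 1 (xxzHamiltonian 1 G (-1) Δ) ((Fintype.card V : ℝ) / 2 - 2)
          - (1 - Δ) * ((G.edgeFinset.card : ℝ) / 4 - G.degree i₀) + (G.edgeFinset.card : ℝ) / 4 := by
    intro Δ Δ' ψ hle gm gn ge hfix
    have h := twoMagnon_level_antitone G hET hreg hm ht2' ht0' hle gm gn ge hfix
    linarith
  rcases h2.lt_or_eq with hlt2 | heq2
  · obtain ⟨h₂𝓜, hs₂, heq₂, hb₂, hfix₂, hvar₂, huniq₂⟩ := hbr Δ₂ ψ₂ hlt2 g₂m g₂n g₂e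
    have h21 := anti h12 g₁m g₁n g₁e hfix₁
    rcases h4.lt_or_eq with hlt4 | heq4
    · -- all four states on the branch
      obtain ⟨h₄𝓜, hs₄, heq₄, hb₄, hfix₄, hvar₄, huniq₄⟩ := hbr Δ₄ ψ₄ hlt4 g₄m g₄n g₄e
      have h43 := anti h34 g₃m g₃n g₃e hfix₃
      exact gram_tp2_of_rankOne_branch hL 𝓜 h𝓜L he𝓜 ht𝓜 hLe he1 ha0
        h₁𝓜 hs₁ heq₁ g₁n hb₁ hvar₁ huniq₁ h₂𝓜 hs₂ heq₂ g₂n hb₂ hvar₂ huniq₂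
        h₃𝓜 hs₃ heq₃ g₃n hb₃ hvar₃ huniq₃ h₄𝓜 hs₄ heq₄ g₄n hb₄ hvar₄ huniq₄ h21 h43
    · -- `Δ₄ = 1`: the flat column
      subst heq4
      obtain ⟨c, hc1, hc⟩ := hflat ψ₄ g₄m g₄n g₄e
      rw [hc, norm_star_dotProduct_smul, norm_star_dotProduct_smul, hc1, one_mul, one_mul]
      exact gram_tp2_flat_column_of_rankOne_branch hL 𝓜 h𝓜L he𝓜 ht𝓜 hLe he1 ha0
        h₁𝓜 hs₁ heq₁ g₁n hb₁ hvar₁ huniq₁ h₂𝓜 hs₂ heq₂ g₂n hb₂ hvar₂ huniq₂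
        h₃𝓜 hs₃ heq₃ g₃n hb₃ hvar₃ huniq₃ h21
  · -- `Δ₂ = 1`: the flat row
    subst heq2
    obtain ⟨c, hc1, hc⟩ := hflat ψ₂ g₂m g₂n g₂e
    rcases h4.lt_or_eq with hlt4 | heq4
    · obtain ⟨h₄𝓜, hs₄, heq₄, hb₄, hfix₄, hvar₄, huniq₄⟩ := hbr Δ₄ ψ₄ hlt4 g₄m g₄n g₄e
      have h43 := anti h34 g₃m g₃n g₃e hfix₃
      have key := gram_tp2_flat_column_of_rankOne_branch hL 𝓜 h𝓜L he𝓜 ht𝓜 hLe he1 ha0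
        h₃𝓜 hs₃ heq₃ g₃n hb₃ hvar₃ huniq₃ h₄𝓜 hs₄ heq₄ g₄n hb₄ hvar₄ huniq₄
        h₁𝓜 hs₁ heq₁ g₁n hb₁ hvar₁ huniq₁ h43
      -- key : ‖⟨ψ₃,e⟩‖ ‖⟨ψ₄,ψ₁⟩‖ ≤ ‖⟨ψ₃,ψ₁⟩‖ ‖⟨ψ₄,e⟩‖
      rw [hc, norm_star_smul_dotProduct, norm_star_smul_dotProduct, hc1, one_mul, one_mul,
        norm_star_dotProduct_comm ψ₁ ψ₄, norm_star_dotProduct_comm e ψ₃, norm_star_dotProduct_comm ψ₁ ψ₃,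
        norm_star_dotProduct_comm e ψ₄]
      linarith [key, mul_comm (‖star ψ₃ ⬝ᵥ e‖) (‖star ψ₄ ⬝ᵥ ψ₁‖),
        mul_comm (‖star ψ₃ ⬝ᵥ ψ₁‖) (‖star ψ₄ ⬝ᵥ e‖)]
    · -- `Δ₂ = Δ₄ = 1`: the flat corner
      subst heq4
      obtain ⟨c', hc1', hc'⟩ := hflat ψ₄ g₄m g₄n g₄e
      have key := gram_flat_corner_of_rankOne_branch hL 𝓜 h𝓜L he𝓜 ht𝓜 hLe he1 ha0
        h₁𝓜 hs₁ heq₁ g₁n hb₁ hvar₁ huniq₁ h₃𝓜 hs₃ heq₃ g₃n hb₃ hvar₃ huniq₃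
      -- key : ‖⟨ψ₁,e⟩‖ ‖⟨e,ψ₃⟩‖ ≤ ‖⟨ψ₁,ψ₃⟩‖
      rw [hc, hc', norm_star_dotProduct_smul, norm_star_smul_dotProduct, norm_star_smul_dotProduct,
        norm_star_dotProduct_smul, hc1, hc1', he1, norm_one]
      simp only [one_mul, mul_one]
      exact key

/-- **(OM) for two magnons on connected vertex- and edge-transitive graphs — ground-state overlap
monotonicity**: for `Δ₁ ≤ Δ₁' ≤ Δ₂ ≤ 1` and normalised two-magnon sector ground states `ψ₁` of
`H(Δ₁)`, `ψ₁'` of `H(Δ₁')`, `φ` of `H(Δ₂)`: `|⟨ψ₁, φ⟩| ≤ |⟨ψ₁', φ⟩|` (TP₂ with rows `(Δ₁, Δ₁')`,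
columns `(Δ₁', Δ₂)`, unit diagonal, Cauchy–Schwarz).  The W = 2 edge-transitive case of the theory
seat's `VertexTransitiveOverlapMonotone` (memo ROTOR-THEORY-6 §50/§52). [folklore] -/
theorem twoMagnon_overlapMonotone_of_edgeTransitive (G : SimpleGraph V) [DecidableRel G.Adj]
    (hG : G.Connected) (hVT : IsVertexTransitive G) (hET : IsEdgeTransitive G)
    {Δ₁ Δ₁' Δ₂ : ℝ} (h1 : Δ₁ ≤ Δ₁') (h2 : Δ₁' ≤ Δ₂) (h3 : Δ₂ ≤ 1)
    {ψ₁ ψ₁' φ : (V → Fin 2) → ℂ}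
    (g₁m : ψ₁ ∈ spinZSector (Λ := V) 1 ((Fintype.card V : ℝ) / 2 - 2)) (g₁n : star ψ₁ ⬝ᵥ ψ₁ = 1)
    (g₁e : xxzHamiltonian 1 G (-1) Δ₁ *ᵥ ψ₁ =
      ((lowestEnergyInSector 1 (xxzHamiltonian 1 G (-1) Δ₁) ((Fintype.card V : ℝ) / 2 - 2) : ℝ) : ℂ) • ψ₁)
    (g₁'m : ψ₁' ∈ spinZSector (Λ := V) 1 ((Fintype.card V : ℝ) / 2 - 2)) (g₁'n : star ψ₁' ⬝ᵥ ψ₁' = 1)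
    (g₁'e : xxzHamiltonian 1 G (-1) Δ₁' *ᵥ ψ₁' =
      ((lowestEnergyInSector 1 (xxzHamiltonian 1 G (-1) Δ₁') ((Fintype.card V : ℝ) / 2 - 2) : ℝ) : ℂ) • ψ₁')
    (gφm : φ ∈ spinZSector (Λ := V) 1 ((Fintype.card V : ℝ) / 2 - 2)) (gφn : star φ ⬝ᵥ φ = 1)
    (gφe : xxzHamiltonian 1 G (-1) Δ₂ *ᵥ φ =
      ((lowestEnergyInSector 1 (xxzHamiltonian 1 G (-1) Δ₂) ((Fintype.card V : ℝ) / 2 - 2) : ℝ) : ℂ) • φ) :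
    ‖star ψ₁ ⬝ᵥ φ‖ ≤ ‖star ψ₁' ⬝ᵥ φ‖ := by
  have tp := twoMagnon_gramTP2_of_edgeTransitive G hG hVT hET h1 (h2.trans h3) h2 h3
    g₁m g₁n g₁e g₁'m g₁'n g₁'e g₁'m g₁'n g₁'e gφm gφn gφe
  -- tp : ‖⟨ψ₁,φ⟩‖ ‖⟨ψ₁',ψ₁'⟩‖ ≤ ‖⟨ψ₁,ψ₁'⟩‖ ‖⟨ψ₁',φ⟩‖
  rw [g₁'n, norm_one, mul_one] at tp
  have hcs : ‖star ψ₁ ⬝ᵥ ψ₁'‖ ≤ 1 := norm_star_dotProduct_le_one g₁n g₁'n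
  calc ‖star ψ₁ ⬝ᵥ φ‖ ≤ ‖star ψ₁ ⬝ᵥ ψ₁'‖ * ‖star ψ₁' ⬝ᵥ φ‖ := tp
    _ ≤ 1 * ‖star ψ₁' ⬝ᵥ φ‖ := by gcongr
    _ = ‖star ψ₁' ⬝ᵥ φ‖ := one_mul _

/-- **TP₂ on every square torus** `(ℤ/Lℤ)²` (connected, vertex- and edge-transitive): the two-magnon
ground-state Gram kernel of `xxzHamiltonian 1 (torusGraph 2 L) (−1) Δ` is TP₂ on `Δ ≤ 1` — the
two-magnon slice of the theory seat's TP-VT conjecture on the tori of `M_Δ`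
(`TorusCondensateMonotone`). [folklore] -/
theorem torusTwoMagnon_gramTP2 (L : ℕ) [NeZero L]
    {Δ₁ Δ₂ Δ₃ Δ₄ : ℝ} (h12 : Δ₁ ≤ Δ₂) (h2 : Δ₂ ≤ 1) (h34 : Δ₃ ≤ Δ₄) (h4 : Δ₄ ≤ 1)
    {ψ₁ ψ₂ ψ₃ ψ₄ : (TorusSite 2 L → Fin 2) → ℂ}
    (g₁m : ψ₁ ∈ spinZSector (Λ := TorusSite 2 L) 1 ((Fintype.card (TorusSite 2 L) : ℝ) / 2 - 2))
    (g₁n : star ψ₁ ⬝ᵥ ψ₁ = 1)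
    (g₁e : xxzHamiltonian 1 (torusGraph 2 L) (-1) Δ₁ *ᵥ ψ₁ =
      ((lowestEnergyInSector 1 (xxzHamiltonian 1 (torusGraph 2 L) (-1) Δ₁)
        ((Fintype.card (TorusSite 2 L) : ℝ) / 2 - 2) : ℝ) : ℂ) • ψ₁)
    (g₂m : ψ₂ ∈ spinZSector (Λ := TorusSite 2 L) 1 ((Fintype.card (TorusSite 2 L) : ℝ) / 2 - 2))
    (g₂n : star ψ₂ ⬝ᵥ ψ₂ = 1)
    (g₂e : xxzHamiltonian 1 (torusGraph 2 L) (-1) Δ₂ *ᵥ ψ₂ =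
      ((lowestEnergyInSector 1 (xxzHamiltonian 1 (torusGraph 2 L) (-1) Δ₂)
        ((Fintype.card (TorusSite 2 L) : ℝ) / 2 - 2) : ℝ) : ℂ) • ψ₂)
    (g₃m : ψ₃ ∈ spinZSector (Λ := TorusSite 2 L) 1 ((Fintype.card (TorusSite 2 L) : ℝ) / 2 - 2))
    (g₃n : star ψ₃ ⬝ᵥ ψ₃ = 1)
    (g₃e : xxzHamiltonian 1 (torusGraph 2 L) (-1) Δ₃ *ᵥ ψ₃ =
      ((lowestEnergyInSector 1 (xxzHamiltonian 1 (torusGraph 2 L) (-1) Δ₃)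
        ((Fintype.card (TorusSite 2 L) : ℝ) / 2 - 2) : ℝ) : ℂ) • ψ₃)
    (g₄m : ψ₄ ∈ spinZSector (Λ := TorusSite 2 L) 1 ((Fintype.card (TorusSite 2 L) : ℝ) / 2 - 2))
    (g₄n : star ψ₄ ⬝ᵥ ψ₄ = 1)
    (g₄e : xxzHamiltonian 1 (torusGraph 2 L) (-1) Δ₄ *ᵥ ψ₄ =
      ((lowestEnergyInSector 1 (xxzHamiltonian 1 (torusGraph 2 L) (-1) Δ₄)
        ((Fintype.card (TorusSite 2 L) : ℝ) / 2 - 2) : ℝ) : ℂ) • ψ₄) :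
    ‖star ψ₁ ⬝ᵥ ψ₄‖ * ‖star ψ₂ ⬝ᵥ ψ₃‖ ≤ ‖star ψ₁ ⬝ᵥ ψ₃‖ * ‖star ψ₂ ⬝ᵥ ψ₄‖ :=
  twoMagnon_gramTP2_of_edgeTransitive (torusGraph 2 L) (torusGraph_connected_of_proj 2 L)
    (torusGraph_isVertexTransitive 2 L) (torusGraph_isEdgeTransitive 2 L) h12 h2 h34 h4
    g₁m g₁n g₁e g₂m g₂n g₂e g₃m g₃n g₃e g₄m g₄n g₄e

end Summit.HubbardSuperconductivity.HubbardSuperconductivity.Theorems.AnisotropyChord.TwoMagnon
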